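import Literature.RepresentationTheory.BorelWallach2000.U11PrincipalSeriesCompositionSeries
import Literature.NumberTheory.Automorphic.GKCompositionMultiplicity
import HarnessLib

/-!
# The principal series `P(s, λ)` of `U(1,1)` is multiplicity-free: `[P(s,λ) : L] ≤ 1` for every `L`, and `[P : D] = [P : F] = [P : D̄] = 1`
# for its composition factors (Bump Thm. 2.5.3 (ii)–(iii), Thm. 2.5.4 (ii), counted; Knapp–Vogan App. A §3 Cor. A.27)

Family `hodge`, lane `lit-hodgefound` (foundations library; seat `lit-hodgefound-p39`, generation 33, row g33-#8); topic
`RepresentationTheory/BorelWallach2000`, namespace `…BorelWallach2000.U11PS` (continued).  Sequel of `U11PrincipalSeriesCompositionSeries`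
(the composition series `series₃ = (0 ⋖ W(a₂) ⋖ W(a₁) ⋖ P)`, `series₂`, `series₁` of the principal series model `psMod s λ` over the
operator ring `R = GKRing G11`, and its composition factors `D_{(a₂, s−a₂)}`, `F_{a₂−a₁−1, a₁}`, `D̄_{(1−a₁, a₁−1−s)}` —
`factors_series₃`, `factors_pairwise_inequivalent`) and of g33-#1/#2/#7 (`JordanHoelder.compMult = [M : S]`, `compMult_le_one_of_pairwise`,
`compMult_pos_of_covBy`, the `(𝔤, K)` reading).  What is formalised: Bump's «three irreducible admissible `(𝔤, K)`-modules … except that if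
`k = 1`, there are only two» COUNTED WITH MULTIPLICITY — each composition factor of `P(s, λ)` occurs exactly once and nothing else occurs.
Theorems only (0 definitions), 0 `sorry`, no named fact (net debt 0, D-0026).

## The sources

D. Bump, *Automorphic Forms and Representations* (1997) [Bump1997, Thm. 2.5.3 (ii)–(iii), Thm. 2.5.4 (ii), p. 200]; A. W. Knapp, D. A. Vogan
(1995) [KnappVogan1995, App. A §3 Cor. A.27] («any two composition series of `M` are equivalent … the composition factors … depend only on
`M`»); Berrick–Keating [BerrickKeating2000, §4.1.11] (the multiplicity `[M : S]`).

## What is formalised (`psMod s λ` = `P(s, λ)` over `R = GKRing G11`)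

* §1 `nonempty_linearEquiv_factor₀/₁/₂` (the three factors of `series₃` as `R`-modules: `≅ D_{(a₂,s−a₂)}`, `≅ F_{a₂−a₁−1,a₁}`,
  `≅ D̄_{(1−a₁,a₁−1−s)}`, realised as `GKRing.asModule` of the tree's model data), `factors_series₂` + `nonempty_linearEquiv_factors₂`
  (the `series₂` companion of `factors_series₃`), `series₃_factors_pairwise`, `series₂_factors_pairwise` (pairwise non-isomorphic).
* §2 **`compMult_le_one`**: `[P(s, λ) : L] ≤ 1` for EVERY `R`-module `L` and all `s`, `λ` (irreducible / double zero / two zeros) —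
  «`π(s₁, s₂, ε)` is reducible, although it does not split», multiplicity-free.
* §3 (two zeros `a₁ ≤ a₂`, `a₁ + a₂ = s + 1`) **`compMult_genDS_eq_one : [P : D_{(a₂, s−a₂)}] = 1`**, **`compMult_genDSBar_eq_one :
  [P : D̄_{(1−a₁, a₁−1−s)}] = 1`**, and for `a₁ < a₂` **`compMult_finRep_eq_one : [P : F_{a₂−a₁−1, a₁}] = 1`**; **`compMult_eq_zero_of_ne`**:
  `[P : L] = 0` for every `L` isomorphic to none of the three (`a₁ < a₂`).
* §4 the irreducible case: `compMult_self_of_irreducible`, `compMult_eq_zero_of_irreducible`.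

## Mathlib / Literature search

`U11PS.series₃/₂`, `series₃_head/_last`, `factors_series₃`, `areGKEquivalent_factor_bot/_mid/_top`, `bot_covBy_upperR`, `upperR_covBy_upperR`,
`upperR_covBy_top`, `isSimpleModule_iff`, `exists_zeros_of_lc_eq_zero`, `factors_pairwise_inequivalent` (Q3713), `AreGKEquivalent.trans'/symm'`;
trunk `GKRing.areGKEquivalent_iff_nonempty_linearEquiv`, `actK_asModule`, `actLie_asModule`; g33-#1/#7 `compMult_le_one_of_pairwise`,
`compMult_pos_of_covBy`, `compMult_eq_seriesMult`, `seriesMult_eq_card`, `compMult_of_isSimpleModule`, `compMult_self`.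
`rg -n 'compMult' BorelWallach2000/U11PrincipalSeries*` → nothing before this file.

## References

* D. Bump, *Automorphic Forms and Representations*, Cambridge Stud. Adv. Math. 55 (1997), §2.5 Thm. 2.5.3, Thm. 2.5.4. [Bump1997]
* A. W. Knapp, D. A. Vogan, *Cohomological Induction and Unitary Representations* (1995), App. A §3 Cor. A.27. [KnappVogan1995]
* A. J. Berrick, M. E. Keating, *An Introduction to Rings and Modules*, CUP (2000), §4.1.11. [BerrickKeating2000]
-/

noncomputable section

open scoped Matrix ComplexConjugate

namespace Literature.RepresentationTheory.BorelWallach2000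

open Literature.Algebra.Module
open Literature.NumberTheory.Automorphic
open Literature.RepresentationTheory.KonnoKonno2007 Literature.RepresentationTheory.KonnoKonno2007.RealDualPair
open Literature.RepresentationTheory.KonnoKonno2007.RealDualPair.UForm
open U11HolDS

-- Mathlib idiom (as in `GKModules`, `GKModuleRing`): commutator bracket on `Module.End`
attribute [local instance 100] LieRing.ofAssociativeRing

-- carriers `↥W`, `M ⧸ W`, `Factor` over `GKRing G11` (as in `GKModuleRing` §7–§8)
set_option maxSynthPendingDepth 4

namespace U11PS

section Multiplicity

variable {s : ℤ} {lam : ℂ}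
variable (L : Type*) [AddCommGroup L] [Module (GKRing G11) L]

/-- Plumbing: a `(𝔤, K)`-equivalence from model data `(ρK, ρ𝔤)` to the data carried by an `R`-module `F` is an `R`-isomorphism
`asModule ρK ρ𝔤 ≅ F` (`Hom_{𝔤,K} = Hom_R`). [cite: KnappVogan1995, Thm. 1.117 (d)] -/
private theorem nonempty_linearEquiv_of_areGKEquivalent {V : Type*} [AddCommGroup V] [Module ℂ V]
    (ρK : Representation ℂ G11.maximalCompact V) (ρ𝔤 : G11.lie →ₗ⁅ℝ⁆ Module.End ℂ V)
    {F : Type*} [AddCommGroup F] [Module ℂ F] [Module (GKRing G11) F] [IsScalarTower ℂ (GKRing G11) F]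
    (h : AreGKEquivalent ρK ρ𝔤 (GKRing.actK G11 F) (GKRing.actLie G11 F)) :
    Nonempty (GKRing.asModule ρK ρ𝔤 ≃ₗ[GKRing G11] F) := by
  have h' : AreGKEquivalent (GKRing.actK G11 (GKRing.asModule ρK ρ𝔤)) (GKRing.actLie G11 (GKRing.asModule ρK ρ𝔤))
      (GKRing.actK G11 F) (GKRing.actLie G11 F) := by
    rwa [GKRing.actK_asModule, GKRing.actLie_asModule]
  exact (GKRing.areGKEquivalent_iff_nonempty_linearEquiv G11).mp h'

/-- Plumbing, converse direction. [cite: KnappVogan1995, Thm. 1.117 (d)] -/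
private theorem areGKEquivalent_of_nonempty_linearEquiv {V : Type*} [AddCommGroup V] [Module ℂ V]
    (ρK : Representation ℂ G11.maximalCompact V) (ρ𝔤 : G11.lie →ₗ⁅ℝ⁆ Module.End ℂ V)
    {V' : Type*} [AddCommGroup V'] [Module ℂ V']
    (σK : Representation ℂ G11.maximalCompact V') (σ𝔤 : G11.lie →ₗ⁅ℝ⁆ Module.End ℂ V')
    (h : Nonempty (GKRing.asModule ρK ρ𝔤 ≃ₗ[GKRing G11] GKRing.asModule σK σ𝔤)) : AreGKEquivalent ρK ρ𝔤 σK σ𝔤 :=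
  (GKRing.areGKEquivalent_iff_nonempty_linearEquiv_asModule ρK ρ𝔤 σK σ𝔤).mpr h

/-! ## §1 The three factors of `series₃` as `R`-modules; pairwise non-isomorphic -/

/-- The bottom factor of `series₃` (its step `0`, on Mathlib's consecutive quotient `GKRing.Factor (0, W(a₂))` = `JordanHoelder.factorOf`
by `GKRing.factor_eq_factorOf`) is `R`-isomorphic to (the operator-ring module of) `D_{(a₂, s−a₂)}`.
[cite: Bump1997, Thm. 2.5.3 (ii)–(iii)] [cite: KnappVogan1995, App. A §3 (A.17)] -/
theorem nonempty_linearEquiv_factor₀ {a₁ a₂ : ℤ} (h₁ : lc s lam a₁ = 0) (h₂ : lc s lam a₂ = 0) (h₁₂ : a₁ + a₂ = s + 1) (hlt : a₁ < a₂) :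
    Nonempty (GKRing.asModule (U11GenDS.kAct a₂ (s - a₂)) (U11GenDS.lieAct a₂ (s - a₂)) ≃ₗ[GKRing G11]
      GKRing.Factor ((series₃ h₁ h₂ h₁₂ hlt) 0, (series₃ h₁ h₂ h₁₂ hlt) 1)) :=
  nonempty_linearEquiv_of_areGKEquivalent _ _ (factors_series₃ h₁ h₂ h₁₂ hlt).1

/-- The middle factor of `series₃` (step `1`, `GKRing.Factor (W(a₂), W(a₁))`) is `R`-isomorphic to `F_{a₂−a₁−1, a₁}`.
[cite: Bump1997, Thm. 2.5.3 (ii)–(iii)] [cite: KnappVogan1995, App. A §3 (A.17)] -/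
theorem nonempty_linearEquiv_factor₁ {a₁ a₂ : ℤ} (h₁ : lc s lam a₁ = 0) (h₂ : lc s lam a₂ = 0) (h₁₂ : a₁ + a₂ = s + 1) (hlt : a₁ < a₂) :
    Nonempty (GKRing.asModule (U11FinRep.kAct (a₂ - 1 - a₁).toNat a₁) (U11FinRep.lieAct (a₂ - 1 - a₁).toNat a₁) ≃ₗ[GKRing G11]
      GKRing.Factor ((series₃ h₁ h₂ h₁₂ hlt) 1, (series₃ h₁ h₂ h₁₂ hlt) 2)) :=
  nonempty_linearEquiv_of_areGKEquivalent _ _ (factors_series₃ h₁ h₂ h₁₂ hlt).2.1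

/-- The top factor of `series₃` (step `2`, `GKRing.Factor (W(a₁), P)`) is `R`-isomorphic to `D̄_{(1−a₁, a₁−1−s)}`.
[cite: Bump1997, Thm. 2.5.3 (ii)–(iii)] [cite: KnappVogan1995, App. A §3 (A.17)] -/
theorem nonempty_linearEquiv_factor₂ {a₁ a₂ : ℤ} (h₁ : lc s lam a₁ = 0) (h₂ : lc s lam a₂ = 0) (h₁₂ : a₁ + a₂ = s + 1) (hlt : a₁ < a₂) :
    Nonempty (GKRing.asModule (U11GenDS.kActBar (1 - a₁) (a₁ - 1 - s)) (U11GenDS.lieActBar (1 - a₁) (a₁ - 1 - s)) ≃ₗ[GKRing G11]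
      GKRing.Factor ((series₃ h₁ h₂ h₁₂ hlt) 2, (series₃ h₁ h₂ h₁₂ hlt) 3)) :=
  nonempty_linearEquiv_of_areGKEquivalent _ _ (factors_series₃ h₁ h₂ h₁₂ hlt).2.2

/-- **The composition factors of the composition series `0 ⋖ W(a₀) ⋖ P(s, λ)` at a double zero** (`2a₀ = s + 1`), on Mathlib's consecutive
quotients: `D_{(a₀, s−a₀)}` and `D̄_{(1−a₀, a₀−1−s)}` (the `series₂` companion of `factors_series₃`; Bump: «if `k = 1`, there are only two»).
[cite: Bump1997, Thm. 2.5.4 (ii)] [cite: KnappVogan1995, App. A §3 (A.17), Cor. A.27] -/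
theorem factors_series₂ {a₀ : ℤ} (h : lc s lam a₀ = 0) (h2 : 2 * a₀ = s + 1) :
    AreGKEquivalent (U11GenDS.kAct a₀ (s - a₀)) (U11GenDS.lieAct a₀ (s - a₀))
        (GKRing.actK G11 (GKRing.Factor ((series₂ h h2) 0, (series₂ h h2) 1)))
        (GKRing.actLie G11 (GKRing.Factor ((series₂ h h2) 0, (series₂ h h2) 1))) ∧
      AreGKEquivalent (U11GenDS.kActBar (1 - a₀) (a₀ - 1 - s)) (U11GenDS.lieActBar (1 - a₀) (a₀ - 1 - s))
        (GKRing.actK G11 (GKRing.Factor ((series₂ h h2) 1, (series₂ h h2) 2)))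
        (GKRing.actLie G11 (GKRing.Factor ((series₂ h h2) 1, (series₂ h h2) 2))) :=
  ⟨areGKEquivalent_factor_bot h (show a₀ + a₀ = s + 1 by omega) le_rfl,
    areGKEquivalent_factor_top h (show a₀ + a₀ = s + 1 by omega) le_rfl⟩

/-- The two factors of `series₂` as `R`-modules: `≅ D_{(a₀, s−a₀)}` and `≅ D̄_{(1−a₀, a₀−1−s)}`. [cite: Bump1997, Thm. 2.5.4 (ii)]
[cite: KnappVogan1995, App. A §3 (A.17)] -/
theorem nonempty_linearEquiv_factors₂ {a₀ : ℤ} (h : lc s lam a₀ = 0) (h2 : 2 * a₀ = s + 1) :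
    Nonempty (GKRing.asModule (U11GenDS.kAct a₀ (s - a₀)) (U11GenDS.lieAct a₀ (s - a₀)) ≃ₗ[GKRing G11]
        GKRing.Factor ((series₂ h h2) 0, (series₂ h h2) 1)) ∧
      Nonempty (GKRing.asModule (U11GenDS.kActBar (1 - a₀) (a₀ - 1 - s)) (U11GenDS.lieActBar (1 - a₀) (a₀ - 1 - s)) ≃ₗ[GKRing G11]
        GKRing.Factor ((series₂ h h2) 1, (series₂ h h2) 2)) :=
  ⟨nonempty_linearEquiv_of_areGKEquivalent _ _ (factors_series₂ h h2).1,
    nonempty_linearEquiv_of_areGKEquivalent _ _ (factors_series₂ h h2).2⟩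

/-- The three model modules `D_{(a₂, s−a₂)}`, `F_{a₂−a₁−1, a₁}`, `D̄_{(1−a₁, a₁−1−s)}` are pairwise non-isomorphic over `R` (Q3713's
`factors_pairwise_inequivalent`, read over the operator ring). [cite: Bump1997, Thm. 2.5.4 (ii)] [cite: KnappVogan1995, Thm. 1.117 (d)] -/
theorem not_nonempty_linearEquiv_models (a₁ a₂ : ℤ) :
    ¬ Nonempty (GKRing.asModule (U11GenDS.kAct a₂ (s - a₂)) (U11GenDS.lieAct a₂ (s - a₂)) ≃ₗ[GKRing G11]
        GKRing.asModule (U11GenDS.kActBar (1 - a₁) (a₁ - 1 - s)) (U11GenDS.lieActBar (1 - a₁) (a₁ - 1 - s))) ∧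
      ¬ Nonempty (GKRing.asModule (U11FinRep.kAct (a₂ - 1 - a₁).toNat a₁) (U11FinRep.lieAct (a₂ - 1 - a₁).toNat a₁) ≃ₗ[GKRing G11]
        GKRing.asModule (U11GenDS.kAct a₂ (s - a₂)) (U11GenDS.lieAct a₂ (s - a₂))) ∧
      ¬ Nonempty (GKRing.asModule (U11FinRep.kAct (a₂ - 1 - a₁).toNat a₁) (U11FinRep.lieAct (a₂ - 1 - a₁).toNat a₁) ≃ₗ[GKRing G11]
        GKRing.asModule (U11GenDS.kActBar (1 - a₁) (a₁ - 1 - s)) (U11GenDS.lieActBar (1 - a₁) (a₁ - 1 - s))) := by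
  obtain ⟨hDDb, hFD, hFDb⟩ := factors_pairwise_inequivalent a₂ (s - a₂) (1 - a₁) (a₁ - 1 - s) (a₂ - 1 - a₁).toNat a₁
  exact ⟨fun h => hDDb (areGKEquivalent_of_nonempty_linearEquiv _ _ _ _ h),
    fun h => hFD (areGKEquivalent_of_nonempty_linearEquiv _ _ _ _ h),
    fun h => hFDb (areGKEquivalent_of_nonempty_linearEquiv _ _ _ _ h)⟩

/-- **The factors of `series₃` are pairwise non-isomorphic `R`-modules.** [cite: Bump1997, Thm. 2.5.4 (ii)] [cite: KnappVogan1995, App. A §3 Cor. A.27] -/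
theorem series₃_factors_pairwise {a₁ a₂ : ℤ} (h₁ : lc s lam a₁ = 0) (h₂ : lc s lam a₂ = 0) (h₁₂ : a₁ + a₂ = s + 1) (hlt : a₁ < a₂)
    (i j : Fin (series₃ h₁ h₂ h₁₂ hlt).length)
    (h : Nonempty (JordanHoelder.factorOf ((series₃ h₁ h₂ h₁₂ hlt) i.castSucc) ((series₃ h₁ h₂ h₁₂ hlt) i.succ) ≃ₗ[GKRing G11]
      JordanHoelder.factorOf ((series₃ h₁ h₂ h₁₂ hlt) j.castSucc) ((series₃ h₁ h₂ h₁₂ hlt) j.succ))) : i = j := by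
  obtain ⟨hDDb, hFD, hFDb⟩ := not_nonempty_linearEquiv_models (s := s) a₁ a₂
  obtain ⟨e₀⟩ := nonempty_linearEquiv_factor₀ h₁ h₂ h₁₂ hlt
  obtain ⟨e₁⟩ := nonempty_linearEquiv_factor₁ h₁ h₂ h₁₂ hlt
  obtain ⟨e₂⟩ := nonempty_linearEquiv_factor₂ h₁ h₂ h₁₂ hlt
  obtain ⟨g⟩ := h
  rcases i with ⟨i, hi⟩
  rcases j with ⟨j, hj⟩
  have hi3 : i < 3 := hi
  have hj3 : j < 3 := hj
  -- the nine cases; off-diagonal ones contradict pairwise non-isomorphism of the models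
  interval_cases i <;> interval_cases j
  · rfl
  · exact absurd ⟨(e₁.trans g.symm).trans e₀.symm⟩ hFD
  · exact absurd ⟨(e₀.trans g).trans e₂.symm⟩ hDDb
  · exact absurd ⟨(e₁.trans g).trans e₀.symm⟩ hFD
  · rfl
  · exact absurd ⟨(e₁.trans g).trans e₂.symm⟩ hFDb
  · exact absurd ⟨(e₀.trans g.symm).trans e₂.symm⟩ hDDb
  · exact absurd ⟨(e₁.trans g.symm).trans e₂.symm⟩ hFDb
  · rfl

/-! ## §2 `P(s, λ)` is multiplicity-free -/

/-- The steps of `series₂` (double zero): factors `W(a₀)/0` and `P/W(a₀)`, with `W(a₀)/0 ≅ D_{(a₀, s−a₀)}` and `P/W(a₀) ≅ D̄_{(1−a₀, a₀−1−s)}`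
non-isomorphic. [cite: Bump1997, Thm. 2.5.4 (ii)] [cite: KnappVogan1995, App. A §3 (A.17)] -/
theorem series₂_factors_pairwise {a₀ : ℤ} (h : lc s lam a₀ = 0) (h2 : 2 * a₀ = s + 1) (i j : Fin (series₂ h h2).length)
    (hij : Nonempty (JordanHoelder.factorOf ((series₂ h h2) i.castSucc) ((series₂ h h2) i.succ) ≃ₗ[GKRing G11]
      JordanHoelder.factorOf ((series₂ h h2) j.castSucc) ((series₂ h h2) j.succ))) : i = j := by
  obtain ⟨hDDb, -, -⟩ := not_nonempty_linearEquiv_models (s := s) a₀ a₀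
  -- factor 0 ≅ D, factor 1 ≅ D̄ (the model pair with `a₁ = a₂ = a₀`)
  obtain ⟨⟨e₀⟩, ⟨e₁⟩⟩ := nonempty_linearEquiv_factors₂ h h2
  obtain ⟨g⟩ := hij
  rcases i with ⟨i, hi⟩
  rcases j with ⟨j, hj⟩
  have hi2 : i < 2 := hi
  have hj2 : j < 2 := hj
  interval_cases i <;> interval_cases j
  · rfl
  · exact absurd ⟨(e₀.trans g).trans e₁.symm⟩ hDDb
  · exact absurd ⟨(e₀.trans g.symm).trans e₁.symm⟩ hDDb
  · rfl

/-- **`P(s, λ)` is multiplicity-free: `[P(s, λ) : L] ≤ 1` for every `R`-module `L`**, for all `s`, `λ` — an irreducible `P(s, λ)` has the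
single factor `P`; at a double zero the two factors `D`, `D̄` are non-isomorphic; for two zeros `a₁ < a₂` the three factors `D`, `F`, `D̄`
are pairwise non-isomorphic («three irreducible … except that if `k = 1`, there are only two», each ONCE).
[cite: Bump1997, Thm. 2.5.3 (i)–(iii), Thm. 2.5.4 (ii)] [cite: KnappVogan1995, App. A §3 Cor. A.27] [cite: BerrickKeating2000, §4.1.11] -/
theorem compMult_le_one : JordanHoelder.compMult (GKRing G11) (psMod s lam) L ≤ 1 := by
  classical
  by_cases hirr : ∀ a : ℤ, lc s lam a ≠ 0
  · haveI : IsSimpleModule (GKRing G11) (psMod s lam) := (isSimpleModule_iff).mpr hirr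
    rw [JordanHoelder.compMult_of_isSimpleModule]
    split_ifs <;> simp
  · push Not at hirr
    obtain ⟨a₀, h⟩ := hirr
    obtain ⟨a₁, a₂, hle, h₁₂, h₁, h₂, -, -⟩ := exists_zeros_of_lc_eq_zero h
    rcases hle.lt_or_eq with hlt | heq
    · exact JordanHoelder.compMult_le_one_of_pairwise L (series₃ h₁ h₂ h₁₂ hlt) rfl rfl (series₃_factors_pairwise h₁ h₂ h₁₂ hlt)
    · subst heq
      exact JordanHoelder.compMult_le_one_of_pairwise L (series₂ h₁ (by omega)) rfl rfl (series₂_factors_pairwise h₁ (by omega))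

/-! ## §3 Each composition factor occurs exactly once; nothing else occurs -/

/-- **`[P(s, λ) : D_{(a₂, s−a₂)}] = 1`** for zeros `a₁ ≤ a₂` of `lc s λ` with `a₁ + a₂ = s + 1` (Bump's `ℌ₊`): the covering pair `0 ⋖ W(a₂)`
has factor `≅ D_{(a₂, s−a₂)}` (`≥ 1`), and `P(s, λ)` is multiplicity-free (`≤ 1`). [cite: Bump1997, Thm. 2.5.3 (ii)–(iii), Thm. 2.5.4 (ii)]
[cite: KnappVogan1995, App. A §3 Cor. A.27] -/
theorem compMult_genDS_eq_one {a₁ a₂ : ℤ} (h₁ : lc s lam a₁ = 0) (h₂ : lc s lam a₂ = 0) (h₁₂ : a₁ + a₂ = s + 1) (hle : a₁ ≤ a₂) :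
    JordanHoelder.compMult (GKRing G11) (psMod s lam)
      (GKRing.asModule (U11GenDS.kAct a₂ (s - a₂)) (U11GenDS.lieAct a₂ (s - a₂))) = 1 := by
  refine le_antisymm (compMult_le_one _) ?_
  obtain ⟨e⟩ := nonempty_linearEquiv_of_areGKEquivalent _ _ (areGKEquivalent_factor_bot h₂ h₁₂ hle)
  exact JordanHoelder.compMult_pos_of_covBy _ isFiniteLength (bot_covBy_upperR h₁ h₂ h₁₂ hle) e.symm

/-- **`[P(s, λ) : D̄_{(1−a₁, a₁−1−s)}] = 1`** (Bump's `ℌ₋`; the covering pair `W(a₁) ⋖ P`). [cite: Bump1997, Thm. 2.5.3 (ii)–(iii), Thm. 2.5.4 (ii)]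
[cite: KnappVogan1995, App. A §3 Cor. A.27] -/
theorem compMult_genDSBar_eq_one {a₁ a₂ : ℤ} (h₁ : lc s lam a₁ = 0) (h₂ : lc s lam a₂ = 0) (h₁₂ : a₁ + a₂ = s + 1) (hle : a₁ ≤ a₂) :
    JordanHoelder.compMult (GKRing G11) (psMod s lam)
      (GKRing.asModule (U11GenDS.kActBar (1 - a₁) (a₁ - 1 - s)) (U11GenDS.lieActBar (1 - a₁) (a₁ - 1 - s))) = 1 := by
  refine le_antisymm (compMult_le_one _) ?_
  obtain ⟨e⟩ := nonempty_linearEquiv_of_areGKEquivalent _ _ (areGKEquivalent_factor_top h₁ h₁₂ hle)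
  exact JordanHoelder.compMult_pos_of_covBy _ isFiniteLength (upperR_covBy_top h₁ h₂ h₁₂ hle) e.symm

/-- **`[P(s, λ) : F_{a₂−a₁−1, a₁}] = 1`** for DISTINCT zeros `a₁ < a₂` (Bump's finite-dimensional constituent, absent when `k = 1`; the
covering pair `W(a₂) ⋖ W(a₁)`). [cite: Bump1997, Thm. 2.5.3 (ii)–(iii), Thm. 2.5.4 (ii)] [cite: KnappVogan1995, App. A §3 Cor. A.27] -/
theorem compMult_finRep_eq_one {a₁ a₂ : ℤ} (h₁ : lc s lam a₁ = 0) (h₂ : lc s lam a₂ = 0) (h₁₂ : a₁ + a₂ = s + 1) (hlt : a₁ < a₂) :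
    JordanHoelder.compMult (GKRing G11) (psMod s lam)
      (GKRing.asModule (U11FinRep.kAct (a₂ - 1 - a₁).toNat a₁) (U11FinRep.lieAct (a₂ - 1 - a₁).toNat a₁)) = 1 := by
  refine le_antisymm (compMult_le_one _) ?_
  obtain ⟨e⟩ := nonempty_linearEquiv_of_areGKEquivalent _ _ (areGKEquivalent_factor_mid h₁ h₂ hlt)
  have h12 : a₁ + a₂ = s + 1 := h₁₂
  exact JordanHoelder.compMult_pos_of_covBy _ isFiniteLength (upperR_covBy_upperR h₁ h₂ h12 hlt) e.symm

/-- Plumbing, any ring: a composition series `0 ⋯ M` none of whose factors is `≅ S` gives `[M : S] = 0`. [cite: BerrickKeating2000, §4.1.11] -/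
private theorem compMult_eq_zero_of_forall_factor {R : Type*} [Ring R] {P : Type*} [AddCommGroup P] [Module R P]
    (S : Type*) [AddCommGroup S] [Module R S] (t : CompositionSeries (Submodule R P)) (hh : t.head = ⊥) (hl : t.last = ⊤)
    (h : ∀ i : Fin t.length, ¬ Nonempty (JordanHoelder.factorOf (t i.castSucc) (t i.succ) ≃ₗ[R] S)) :
    JordanHoelder.compMult R P S = 0 := by
  classical
  rw [JordanHoelder.compMult_eq_seriesMult S t hh hl, JordanHoelder.seriesMult_eq_card, Finset.card_eq_zero,
    Finset.filter_eq_empty_iff]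
  exact fun i _ => h i

/-- **Nothing else occurs: `[P(s, λ) : L] = 0` for every `R`-module `L` isomorphic to none of `D_{(a₂, s−a₂)}`, `F_{a₂−a₁−1, a₁}`,
`D̄_{(1−a₁, a₁−1−s)}`** (`a₁ < a₂`; the factors of the composition series `series₃` are exactly these). [cite: Bump1997, Thm. 2.5.4 (ii)]
[cite: KnappVogan1995, App. A §3 Cor. A.27] -/
theorem compMult_eq_zero_of_ne {a₁ a₂ : ℤ} (h₁ : lc s lam a₁ = 0) (h₂ : lc s lam a₂ = 0) (h₁₂ : a₁ + a₂ = s + 1) (hlt : a₁ < a₂)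
    (hD : ¬ Nonempty (GKRing.asModule (U11GenDS.kAct a₂ (s - a₂)) (U11GenDS.lieAct a₂ (s - a₂)) ≃ₗ[GKRing G11] L))
    (hF : ¬ Nonempty (GKRing.asModule (U11FinRep.kAct (a₂ - 1 - a₁).toNat a₁) (U11FinRep.lieAct (a₂ - 1 - a₁).toNat a₁) ≃ₗ[GKRing G11] L))
    (hDb : ¬ Nonempty (GKRing.asModule (U11GenDS.kActBar (1 - a₁) (a₁ - 1 - s)) (U11GenDS.lieActBar (1 - a₁) (a₁ - 1 - s))
      ≃ₗ[GKRing G11] L)) :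
    JordanHoelder.compMult (GKRing G11) (psMod s lam) L = 0 := by
  obtain ⟨e₀⟩ := nonempty_linearEquiv_factor₀ h₁ h₂ h₁₂ hlt
  obtain ⟨e₁⟩ := nonempty_linearEquiv_factor₁ h₁ h₂ h₁₂ hlt
  obtain ⟨e₂⟩ := nonempty_linearEquiv_factor₂ h₁ h₂ h₁₂ hlt
  refine compMult_eq_zero_of_forall_factor L (series₃ h₁ h₂ h₁₂ hlt) rfl rfl fun i => ?_
  rcases i with ⟨i, hi⟩
  have hi3 : i < 3 := hi
  interval_cases i
  · exact fun ⟨g⟩ => hD ⟨e₀.trans g⟩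
  · exact fun ⟨g⟩ => hF ⟨e₁.trans g⟩
  · exact fun ⟨g⟩ => hDb ⟨e₂.trans g⟩

/-- At a DOUBLE zero only `D` and `D̄` occur: `[P(s, λ) : L] = 0` for every `L` isomorphic to neither. [cite: Bump1997, Thm. 2.5.4 (ii)]
[cite: KnappVogan1995, App. A §3 Cor. A.27] -/
theorem compMult_eq_zero_of_ne₂ {a₀ : ℤ} (h : lc s lam a₀ = 0) (h2 : 2 * a₀ = s + 1)
    (hD : ¬ Nonempty (GKRing.asModule (U11GenDS.kAct a₀ (s - a₀)) (U11GenDS.lieAct a₀ (s - a₀)) ≃ₗ[GKRing G11] L))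
    (hDb : ¬ Nonempty (GKRing.asModule (U11GenDS.kActBar (1 - a₀) (a₀ - 1 - s)) (U11GenDS.lieActBar (1 - a₀) (a₀ - 1 - s))
      ≃ₗ[GKRing G11] L)) :
    JordanHoelder.compMult (GKRing G11) (psMod s lam) L = 0 := by
  obtain ⟨⟨e₀⟩, ⟨e₁⟩⟩ := nonempty_linearEquiv_factors₂ h h2
  refine compMult_eq_zero_of_forall_factor L (series₂ h h2) rfl rfl fun i => ?_
  rcases i with ⟨i, hi⟩
  have hi2 : i < 2 := hi
  interval_cases i
  · exact fun ⟨g⟩ => hD ⟨e₀.trans g⟩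
  · exact fun ⟨g⟩ => hDb ⟨e₁.trans g⟩

/-! ## §4 The irreducible case -/

/-- An irreducible `P(s, λ)` (no zero of `lc s λ`) has `[P : P] = 1`. [cite: Bump1997, Thm. 2.5.3 (i)] [cite: BerrickKeating2000, §4.1.11] -/
theorem compMult_self_of_irreducible (hirr : ∀ a : ℤ, lc s lam a ≠ 0) :
    JordanHoelder.compMult (GKRing G11) (psMod s lam) (psMod s lam) = 1 := by
  haveI : IsSimpleModule (GKRing G11) (psMod s lam) := (isSimpleModule_iff).mpr hirr
  exact JordanHoelder.compMult_self _

/-- … and `[P : L] = 0` for every `L ≇ P`. [cite: Bump1997, Thm. 2.5.3 (i)] [cite: BerrickKeating2000, §4.1.11] -/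
theorem compMult_eq_zero_of_irreducible (hirr : ∀ a : ℤ, lc s lam a ≠ 0) (hL : ¬ Nonempty (psMod s lam ≃ₗ[GKRing G11] L)) :
    JordanHoelder.compMult (GKRing G11) (psMod s lam) L = 0 := by
  classical
  haveI : IsSimpleModule (GKRing G11) (psMod s lam) := (isSimpleModule_iff).mpr hirr
  rw [JordanHoelder.compMult_of_isSimpleModule, if_neg hL]

end Multiplicity

end U11PS

end Literature.RepresentationTheory.BorelWallach2000
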